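import Summits.QuantumFields.GaugeBoot.BootstrapCentreSymmetry
import HarnessLib

/-!
# Internal symmetries of the bootstrap V: the `N`-ality selection rule for wound Polyakov loops (gauge-boot, L1 supplement)

HONEST FRAMING (cell `pub-gaugeboot`, page 1 of every file): the venture produces certified bounds
on lattice expectations at stated coupling, gauge group, dimension and torus size; NOT a mass gap,
NOT a continuum limit, NOT a string tension; NOT Yang–Mills-summit-bearing (barriers
`FixedCouplingUltralocality`, `PerturbativeInvisibility`). Structural; it certifies no number.
Nothing here concerns temperature, deconfinement or infinite volume.

## Content

`BootstrapCentreSymmetry` showed that every bootstrap solution kills the simply wound Polyakov loops.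
Here the `k`-fold wound ones, `tr hol_y(kL·e_m)` (`polyakovWord m (k * L)`):

* `wordHolonomy_polyakov_pow_sheetTwist` — based on the sheet, the `k`-fold Polyakov loop picks up
  `z^k` under the centre sheet twist by `z`;
* `cos_two_pi_mul_div_ne_one` — `cos(2πk/N) ≠ 1` unless `N ∣ k`;
* ★★★ `polyakov_pow_eq_zero_of_bootstrap_suN` — `SU(N)`, ANY real `β`, any torus: every solution of
  the untruncated bootstrap assigns `0` to `Re` and `Im tr hol_y(kL·e_m)` whenever `N ∤ k` (nonzero
  `N`-ality); ★★★ `wilson_polyakov_pow_eq_zero_suN` — in particular the Wilson state (the `ℤ_N`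
  selection rule; the tree's `wilsonExpectation_prod_polyakovLines_eq_zero_of_odd` is the `ℤ₂` case).

References: G. 't Hooft, Nucl. Phys. B 153 (1979) 141; B. Svetitsky, L. Yaffe, Nucl. Phys. B 210
(1982) 423. Folklore.
-/

noncomputable section

open MeasureTheory Filter Topology NormedSpace
open scoped Matrix ComplexConjugate
open Literature.MathematicalPhysics.QuantumFieldTheory (LatticeRep Site Edge GaugeConfig wilsonAction wilsonMeasure
  isProbabilityMeasure_wilsonMeasure)

namespace Summit.QuantumFields.GaugeBoot

/-! ## Wound Polyakov loops under the sheet twist -/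

section Wound

variable {d L : ℕ} {G : Type*} [Group G]

/-- `(k+1)`-fold winding = one lap followed by `k` laps. -/
theorem polyakovWord_succ_mul (m : Fin d) (k : ℕ) :
    polyakovWord (d := d) m ((k + 1) * L) = polyakovWord m L ++ polyakovWord m (k * L) := by
  rw [polyakovWord, polyakovWord, polyakovWord, ← List.replicate_add, Nat.succ_mul, add_comm]

/-- Wound Polyakov loops are closed. -/
theorem endpoint_polyakovWord_mul (x : Site d L) (m : Fin d) (k : ℕ) :
    Word.endpoint x (polyakovWord m (k * L)) = x := by
  rw [endpoint_polyakovWord, Nat.cast_mul, ZMod.natCast_self, mul_zero, Pi.single_zero, add_zero]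

/-- ★ **The `k`-fold Polyakov loop based on the sheet picks up `z^k`.** -/
theorem wordHolonomy_polyakov_pow_sheetTwist [NeZero L] (m : Fin d) {z : G} (hz : z ∈ Subgroup.center G)
    (U : GaugeConfig d L G) {x : Site d L} (hx : x m = 0) (k : ℕ) :
    wordHolonomy (sheetTwist m z U) x (polyakovWord m (k * L)) = z ^ k * wordHolonomy U x (polyakovWord m (k * L)) := by
  induction k with
  | zero => simp [polyakovWord]
  | succ k ih =>
    rw [polyakovWord_succ_mul, wordHolonomy_append, wordHolonomy_append, endpoint_polyakovWord_self,
      wordHolonomy_polyakov_sheetTwist m z U hx, ih, pow_succ]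
    -- `z · a · (z^k · b) = z^k · z · (a · b)` by centrality of `z^k`
    have hzk : z ^ k ∈ Subgroup.center G := Subgroup.pow_mem _ hz k
    rw [mul_central_left hzk]
    simp only [mul_assoc]

end Wound

/-! ## `SU(N)`: the selection rule -/

section Unitary

open Literature.MathematicalPhysics.QuantumLattice (fundamentalLatticeRep fundamentalRep continuous_fundamentalRep)

variable {d L : ℕ} [NeZero L] (N : ℕ)

/-- `ω^k = e^{iθ}` with `θ = 2πk/N`. -/
theorem centrePhase_pow_eq_exp (k : ℕ) :
    centrePhase N ^ k = Complex.exp ((2 * Real.pi * k / N : ℝ) * Complex.I) := by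
  rw [centrePhase_eq_exp_mul_I, ← Complex.exp_nat_mul]
  congr 1
  push_cast
  ring

/-- **`cos(2πk/N) ≠ 1` unless `N ∣ k`** (`N ≥ 1`). -/
theorem cos_two_pi_mul_div_ne_one (hN : N ≠ 0) {k : ℕ} (hk : ¬ N ∣ k) : Real.cos (2 * Real.pi * k / N) ≠ 1 := by
  intro h
  obtain ⟨n, hn⟩ := (Real.cos_eq_one_iff _).1 h
  have hNpos : (0 : ℝ) < N := by exact_mod_cast Nat.pos_of_ne_zero hN
  have h1 : (n : ℝ) * N = k := by
    field_simp at hn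
    nlinarith [Real.pi_pos]
  have h2 : (n : ℤ) * (N : ℤ) = (k : ℤ) := by exact_mod_cast h1
  exact hk (Int.natCast_dvd_natCast.1 (Dvd.intro_left n h2))

/-- The trace of `z^k · h`: `tr ρ(centreRoot^k · h) = ω^k tr ρ(h)`. -/
theorem rho_trace_centreRoot_pow_mul (k : ℕ) (h : Matrix.specialUnitaryGroup (Fin N) ℂ) :
    ((fundamentalLatticeRep N).ρ (centreRoot N ^ k * h)).trace = centrePhase N ^ k * ((fundamentalLatticeRep N).ρ h).trace := by
  induction k generalizing h with
  | zero => simp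
  | succ k ih =>
    rw [pow_succ, mul_assoc, ih, rho_trace_centreRoot_mul, pow_succ]
    ring

/-- The wound Polyakov loop on the sheet is rotated by `2πk/N` (real part). -/
theorem loopRe_polyakov_pow_comp_sheetTwist (m : Fin d) {x : Site d L} (hx : x m = 0) (k : ℕ) :
    (loopRe (fundamentalLatticeRep N) x (polyakovWord m (k * L))).comp
        (sheetTwistCM m (centreRoot N : Matrix.specialUnitaryGroup (Fin N) ℂ)) =
      Real.cos (2 * Real.pi * k / N) • loopRe (fundamentalLatticeRep N) x (polyakovWord m (k * L)) -
        Real.sin (2 * Real.pi * k / N) • loopIm (fundamentalLatticeRep N) x (polyakovWord m (k * L)) := by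
  ext U
  simp only [ContinuousMap.comp_apply, ContinuousMap.sub_apply, ContinuousMap.smul_apply, loopRe_apply, loopIm_apply,
    sheetTwistCM_apply, smul_eq_mul]
  rw [wordHolonomy_polyakov_pow_sheetTwist m (centreRoot_mem_center N) U hx, rho_trace_centreRoot_pow_mul,
    centrePhase_pow_eq_exp, Complex.mul_re, Complex.exp_ofReal_mul_I_re, Complex.exp_ofReal_mul_I_im]

/-- The wound Polyakov loop on the sheet is rotated by `2πk/N` (imaginary part). -/
theorem loopIm_polyakov_pow_comp_sheetTwist (m : Fin d) {x : Site d L} (hx : x m = 0) (k : ℕ) :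
    (loopIm (fundamentalLatticeRep N) x (polyakovWord m (k * L))).comp
        (sheetTwistCM m (centreRoot N : Matrix.specialUnitaryGroup (Fin N) ℂ)) =
      Real.sin (2 * Real.pi * k / N) • loopRe (fundamentalLatticeRep N) x (polyakovWord m (k * L)) +
        Real.cos (2 * Real.pi * k / N) • loopIm (fundamentalLatticeRep N) x (polyakovWord m (k * L)) := by
  ext U
  simp only [ContinuousMap.comp_apply, ContinuousMap.add_apply, ContinuousMap.smul_apply, loopRe_apply, loopIm_apply,
    sheetTwistCM_apply, smul_eq_mul]
  rw [wordHolonomy_polyakov_pow_sheetTwist m (centreRoot_mem_center N) U hx, rho_trace_centreRoot_pow_mul,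
    centrePhase_pow_eq_exp, Complex.mul_im, Complex.exp_ofReal_mul_I_re, Complex.exp_ofReal_mul_I_im]
  ring

variable (β : ℝ)

/-- ★★★ **The `N`-ality selection rule for every bootstrap solution** (`SU(N)`, `N ≥ 1`, any real
`β`, any torus): if `N ∤ k`, every solution of the untruncated bootstrap assigns `0` to the real and
imaginary parts of every `k`-fold wound Polyakov loop `tr hol_y(kL·e_m)`. [folklore] -/
theorem polyakov_pow_eq_zero_of_bootstrap_suN (hN : N ≠ 0) {k : ℕ} (hk : ¬ N ∣ k)
    {φ : C(GaugeConfig d L (Matrix.specialUnitaryGroup (Fin N) ℂ), ℝ) →ₗ[ℝ] ℝ} (h1 : φ 1 = 1)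
    (hpos : ∀ a ∈ polyAlgebra (ι := Edge d L) (fundamentalLatticeRep N), 0 ≤ φ (a * a))
    (hφ : IsSDFunctional (fundamentalLatticeRep N) (suExp N) (fun _ => wilsonAction (fundamentalRep (Fin N))) β φ)
    (y : Site d L) (m : Fin d) :
    φ (loopRe (fundamentalLatticeRep N) y (polyakovWord m (k * L))) = 0 ∧
      φ (loopIm (fundamentalLatticeRep N) y (polyakovWord m (k * L))) = 0 := by
  obtain ⟨x, a, hx, rfl⟩ := exists_sheet_translate y m
  rw [← loopRe_comp_translate, ← loopIm_comp_translate,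
    bootstrap_translationInvariant_suN N β h1 hpos hφ a (loopRe_mem _ x _),
    bootstrap_translationInvariant_suN N β h1 hpos hφ a (loopIm_mem _ x _)]
  have hA := bootstrap_sheetTwistInvariant_suN N β m (centreRoot_mem_center N) h1 hpos hφ
    (loopRe_mem (fundamentalLatticeRep N) x (polyakovWord m (k * L)))
  have hB := bootstrap_sheetTwistInvariant_suN N β m (centreRoot_mem_center N) h1 hpos hφ
    (loopIm_mem (fundamentalLatticeRep N) x (polyakovWord m (k * L)))
  rw [loopRe_polyakov_pow_comp_sheetTwist N m hx k, map_sub, map_smul, map_smul, smul_eq_mul, smul_eq_mul] at hA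
  rw [loopIm_polyakov_pow_comp_sheetTwist N m hx k, map_add, map_smul, map_smul, smul_eq_mul, smul_eq_mul] at hB
  exact eq_zero_of_rotation_fixed (cos_two_pi_mul_div_ne_one N hN hk) (Real.cos_sq_add_sin_sq _) hA hB

/-- ★★★ **The `ℤ_N` selection rule for the Wilson state**: `∫ Re/Im tr hol_y(kL·e_m) dμ = 0` for
`N ∤ k`, every `β`, `d`, `L`, `y`, `m`. [folklore] -/
theorem wilson_polyakov_pow_eq_zero_suN (hN : N ≠ 0) {k : ℕ} (hk : ¬ N ∣ k) (y : Site d L) (m : Fin d) :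
    ∫ U, loopRe (fundamentalLatticeRep N) y (polyakovWord m (k * L)) U
        ∂(wilsonMeasure (d := d) (L := L) (fundamentalRep (Fin N)) β) = 0 ∧
      ∫ U, loopIm (fundamentalLatticeRep N) y (polyakovWord m (k * L)) U
        ∂(wilsonMeasure (d := d) (L := L) (fundamentalRep (Fin N)) β) = 0 := by
  haveI : IsProbabilityMeasure (wilsonMeasure (d := d) (L := L) (fundamentalRep (Fin N)) β) :=
    isProbabilityMeasure_wilsonMeasure (ρ := fundamentalRep (Fin N)) (continuous_fundamentalRep _) β
  obtain ⟨h1, hpos, hsd⟩ := bootstrap_wilson_suN (d := d) (L := L) N β (wilsonMeasure (fundamentalRep (Fin N)) β) rfl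
  have h := polyakov_pow_eq_zero_of_bootstrap_suN N β hN hk h1 (fun a _ => hpos a) hsd y m
  rwa [expectationFunctional_apply, expectationFunctional_apply] at h

end Unitary

end Summit.QuantumFields.GaugeBoot

end
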